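import Mathlib

/-!
# Barrier: the van den Berg–Häggström–Kahn MIXED-GRAPH conjecture (Theorem 3.4 "without the
# restriction" to purely directed graphs) is FALSE — kernel refutation (NEG-76, BLIND-DERIVED)

Barrier catalogue `Literature/Barriers/CriticalPhenomena/` (D-0021), entry for the conjunct
`PercolationContinuityZ3` (Kozma–Nitzan reduction; two-cluster conditional correlation tools), companion
of `BHKTwoClusterOrientedCounterexample.lean` (which records the printed four-vertex example showing that
the conditionings `{s ↛ t}`, `{s ↛ t ↛ s}` do not work for oriented percolation, and names the
conditioning `Q` that does work for pure digraphs).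

PROVENANCE.  This entry is an INDEX entry for a result found and kernel-checked in the venture (blind cell)
`pub-perc-repro2`: `Summits/Ventures/PercRepro2/BHKMixedCounterexample.lean` (p370416, the seven-vertex
witness `W1e7` of that cell's NEGATIVE.md NEG-76, "re-derived exactly by three independent implementations")
and `Summits/Ventures/PercRepro2/BHKMixedCore.lean` (p371592, the six-vertex minimal mechanism).  A
Literature file may not import `Summits.Ventures.*` (gate lint `lint.import`), so instead of re-exporting
those theorems this file RE-EVALUATES the same two finite witnesses with one generic evaluator written in
the venture files' own encoding (edges as `(arc?, u, v, w)` with open-probability `w/8`, configurations as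
bitmasks, `V(C_v)` by a reachability fixpoint); the four masses of each witness come out equal to the
venture files' values (`massQ = 12451840`, … resp. `384896`, …).  Everything is PROVED (finite sums over
`2^8`, resp. `2^7`, edge configurations evaluated by `decide +kernel`, then `norm_num`); standard axioms;
no facts, no sorries.  This file adds no mathematics to the venture's result.

**Printed claim.**  Setting [cite: VandenbergHaggstromKahn2005, §3 (setup)]: "some (or all, or none) of
the edges of our graph are oriented … When we speak of a path, we will now mean one which respects the
orientations of its oriented edges"; `C_s` is "the set of all edges contained in open paths starting at
`s`"; `V(F)` is the set of vertices incident with edges of `F`.  The positive result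
[cite: VandenbergHaggstromKahn2005, §3, Theorem 3.4]: "Theorem 3.4. Assume `G` is a digraph in the usual
sense (that is, all its edges are directed). Let `s` and `t` be (distinct) vertices, and `f` and `g`
bounded, measurable functions of `(C_s, C_t)`, each increasing in `C_s` and decreasing in `C_t`. Then on
`Q := {V(C_s) ∩ V(C_t) = ∅}`, `E fg ≥ E f E g`."  The conjecture refuted here is the sentence that follows
it [cite: VandenbergHaggstromKahn2005, §3, paragraph after Theorem 3.4 (arXiv:math/0408176, p. 18)]:
«It's a little strange that we can so far prove Theorem 3.4 only in the absence of undirected edges, and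
we conjecture that it remains true without this restriction. (The difficulties in extending the proof
below—those for the other version are essentially the same—are the (related) failures of Observation (U)
and of the validity of the hypothesis (iii) when we come to apply Lemma [LPA].)»  (The arXiv source's
internal cross-reference prints "Theorem (3.5)" for the theorem numbered 3.4 in the text; same statement.)

**The refutation (kernel).**  Read "without this restriction" as: the same statement on a MIXED graph
(independent edges, some oriented and some undirected, undirected edges usable in both directions, paths
respecting the orientation of oriented edges; `C_v`, `V(·)`, `Q` as printed), with the conclusion read as
`E[fg | Q] ≥ E[f | Q] · E[g | Q]`.  Two explicit finite witnesses, each with `f` the indicator that a fixed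
vertex lies in `V(C_s)` (increasing in `C_s`, constant in `C_t`) and `g` the indicator that a fixed vertex
does NOT lie in `V(C_t)` (constant in `C_s`, decreasing in `C_t`) — admissible pairs for Theorem 3.4 — give
a strictly NEGATIVE conditional covariance on `Q`:

* `W1e7` (NEG-76 witness of record): seven vertices `0..6`, `s = 5`, `t = 0`, undirected edges `{4,5}`,
  `{0,3}` (probability `1`), `{0,6}`, `{1,2}` (probability `1/2`), arcs `(2,3)` (probability `7/8`), `(1,4)`,
  `(4,1)`, `(6,2)` (probability `1/2`), `f = 1[1 ∈ V(C_s)]`, `g = 1[6 ∉ V(C_t)]`:  `P(Q) = 95/128`,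
  `E[f;Q] = 35/128`, `E[g;Q] = 50/128`, `E[fg;Q] = 18/128`, so
  `E[fg | Q] − E[f | Q]·E[g | Q] = 18/95 − (7/19)(10/19) = −8/1805 < 0`
  (`VdBHKMixed.seven_conditional_covariance`, `vdBHK_mixed_conjecture_false`);
* the MINIMAL MECHANISM `K6`: six vertices `s = 0`, `t = 1`, `x = 2`, `y = 3`, `s' = 4`, `t' = 5`,
  opposite-arc pairs `s ⇄ x`, `t ⇄ y`, ONE undirected edge `{x, y}`, pendant arcs `s → s'`, `t → t'` (they
  only make `s ∈ V(C_s)`, `t ∈ V(C_t)` possible in the paper's convention), EVERY weight `7/8`,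
  `f = 1[x ∈ V(C_s)]`, `g = 1[y ∉ V(C_t)]`:  `P(Q) = 3007/16384`, `E[f;Q] = 4319/32768`,
  `E[g;Q] = 1695/32768`, `E[fg;Q] = 1183/32768`, `E[fg | Q] − E[f | Q]·E[g | Q] = −206143/36168196 < 0`
  (`VdBHKMixed.six_conditional_covariance`, `vdBHK_mixed_conjecture_false_six`).  With the pendant arcs
  deterministic and the core at a uniform weight `p` the covariance is `−p³(1−p)(p²+p−1)/(1+p+p²−2p³)²`
  (venture file's closed form, not re-proved here), negative exactly for `p > (√5−1)/2`: given `Q`, the two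
  forward clusters compete for the single coin `{x, y}` — `s → x` open and `t → y` open force that edge
  closed — which is the failure of Observation (U) the authors anticipated.

## Contents
* `VdBHKMixed.MEdge`, `VdBHKMixed.wt/step/iter/reach/VC/Q/mass` — the generic finite evaluator (the venture
  files' encoding, parameterised by the edge list and vertex count).
* `VdBHKMixed.sevenEdges` / `sixEdges` and the eight mass theorems (`decide +kernel`), total-mass sanity
  checks, `P(Q)` values and the two exact conditional covariances.
* `vdBHK_mixed_conjecture_false` (seven-vertex), `vdBHK_mixed_conjecture_false_six` (six-vertex): the
  barrier statements `E[fg | Q] < E[f | Q]·E[g | Q]`, the first carrying the D-0021 structured block.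

## References
* J. van den Berg, O. Häggström, J. Kahn, *Some conditional correlation inequalities for percolation and
  related processes*, Random Structures Algorithms 29 (2006) 417–435 (arXiv:math/0408176): §3, Theorem 3.4
  and the paragraph following it [VandenbergHaggstromKahn2005].
-/

namespace Literature.Barriers.CriticalPhenomena

namespace VdBHKMixed

/-- An edge of a finite mixed graph in the venture cell's encoding: `arc = true` is the arc `u → v`,
`arc = false` the undirected edge `{u, v}`; the edge is open, independently, with probability `w / 8`
[cite: VandenbergHaggstromKahn2005, §3 (setup: "some (or all, or none) of the edges of our graph are oriented")]. -/
structure MEdge where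
  /-- `true`: oriented arc `u → v`; `false`: undirected edge `{u, v}`. -/
  arc : Bool
  /-- tail (or first endpoint) -/
  u : Nat
  /-- head (or second endpoint) -/
  v : Nat
  /-- open with probability `w / 8` -/
  w : Nat

/-- The `i`-th edge of the list (a closed dummy arc beyond the end; never reached below). [folklore] -/
def edgeAt (E : List MEdge) (i : Nat) : MEdge := E.getD i ⟨true, 0, 0, 0⟩

/-- Edge `i` is open in configuration `c ∈ [0, 2^|E|)` iff bit `i` of `c` is set. [folklore] -/
def isOpen (c i : Nat) : Bool := c.testBit i

/-- Vertex sets are bitmasks; `mem S x` is `x ∈ S`. [folklore] -/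
def mem (S x : Nat) : Bool := S.testBit x

/-- Product Bernoulli weight of configuration `c` in units of `8^{-|E|}`: `∏_i (w_i if open else 8 − w_i)`
[cite: VandenbergHaggstromKahn2005, §1 (independent bond percolation)]. -/
def wt (E : List MEdge) (c : Nat) : Nat :=
  (List.range E.length).foldl
    (fun acc i => acc * (if isOpen c i then (edgeAt E i).w else 8 - (edgeAt E i).w)) 1

/-- One expansion step of a vertex set along the open edges: arcs forward only, undirected edges both
ways ("a path … respects the orientations of its oriented edges")
[cite: VandenbergHaggstromKahn2005, §3 (setup)]. -/
def step (E : List MEdge) (c S : Nat) : Nat :=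
  (List.range E.length).foldl (fun S i =>
    let e := edgeAt E i
    if isOpen c i then
      let S₁ := if mem S e.u then S ||| (1 <<< e.v) else S
      if e.arc then S₁ else (if mem S₁ e.v then S₁ ||| (1 <<< e.u) else S₁)
    else S) S

/-- `n`-fold iteration of `step`. [folklore] -/
def iter (E : List MEdge) (c : Nat) : Nat → Nat → Nat
  | 0, S => S
  | n + 1, S => iter E c n (step E c S)

/-- `R(v)`: vertices reachable from `v` along open orientation-respecting paths (`v` included); `nV`
steps suffice on `nV` vertices [cite: VandenbergHaggstromKahn2005, §3 (setup: the event `{s → t}`)]. -/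
def reach (E : List MEdge) (nV c v : Nat) : Nat := iter E c nV (1 <<< v)

/-- `V(C_v)`: the endpoints of the open edges lying on an open path starting at `v`, i.e. of the open edges
usable from a vertex of `R(v)` (an arc from its tail, an undirected edge from either end)
[cite: VandenbergHaggstromKahn2005, §3 (setup: "The open cluster, `C_s`, of `s` is again the set of all edges contained in open paths starting at `s`"; `V(F)` before Theorem 3.4)]. -/
def VC (E : List MEdge) (nV c v : Nat) : Nat :=
  let R := reach E nV c v
  (List.range E.length).foldl (fun S i =>
    let e := edgeAt E i
    if isOpen c i && (mem R e.u || (!e.arc && mem R e.v)) then S ||| (1 <<< e.u) ||| (1 <<< e.v)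
    else S) 0

/-- The conditioning event `Q = {V(C_s) ∩ V(C_t) = ∅}` [cite: VandenbergHaggstromKahn2005, §3, Theorem 3.4]. -/
def Q (E : List MEdge) (nV s t c : Nat) : Bool := (VC E nV c s &&& VC E nV c t) == 0

/-- `8^|E| · E[1_Q · 1_P]`: the total weight of the configurations in `Q` satisfying `P`
[cite: VandenbergHaggstromKahn2005, §3, Theorem 3.4]. -/
def mass (E : List MEdge) (nV s t : Nat) (P : Nat → Bool) : Nat :=
  (List.range (2 ^ E.length)).foldl (fun a c => if Q E nV s t c && P c then a + wt E c else a) 0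

/-! ### The seven-vertex witness `W1e7` (NEG-76; venture file `BHKMixedCounterexample.lean`, p370416) -/

/-- The eight edges of `W1e7` on vertices `0..6` (`s = 5`, `t = 0`): `{4,5}`, `{0,3}` sure; `(2,3)` at
`7/8`; `{0,6}`, `{1,2}`, `(1,4)`, `(4,1)`, `(6,2)` at `1/2` — verbatim the venture cell's list. [folklore] -/
def sevenEdges : List MEdge :=
  [⟨false, 4, 5, 8⟩, ⟨false, 0, 3, 8⟩, ⟨true, 2, 3, 7⟩, ⟨false, 0, 6, 4⟩,
   ⟨false, 1, 2, 4⟩, ⟨true, 1, 4, 4⟩, ⟨true, 4, 1, 4⟩, ⟨true, 6, 2, 4⟩]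

/-- `f = 1[1 ∈ V(C_s)]` on `W1e7` (`s = 5`): increasing in `C_s`, constant in `C_t`. [folklore] -/
def sevenF (c : Nat) : Bool := mem (VC sevenEdges 7 c 5) 1

/-- `g = 1[6 ∉ V(C_t)]` on `W1e7` (`t = 0`): constant in `C_s`, decreasing in `C_t`. [folklore] -/
def sevenG (c : Nat) : Bool := !(mem (VC sevenEdges 7 c 0) 6)

/-- `8^8 · P(Q)` on `W1e7`. [folklore] -/
def sevenMassQ : Nat := mass sevenEdges 7 5 0 fun _ => true
/-- `8^8 · E[f; Q]` on `W1e7`. [folklore] -/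
def sevenMassFQ : Nat := mass sevenEdges 7 5 0 sevenF
/-- `8^8 · E[g; Q]` on `W1e7`. [folklore] -/
def sevenMassGQ : Nat := mass sevenEdges 7 5 0 sevenG
/-- `8^8 · E[fg; Q]` on `W1e7`. [folklore] -/
def sevenMassFGQ : Nat := mass sevenEdges 7 5 0 fun c => sevenF c && sevenG c

/-- Sanity: the weights of all `2^8` configurations of `W1e7` sum to `8^8`. [folklore] -/
private theorem seven_total_mass :
    (List.range 256).foldl (fun a c => a + wt sevenEdges c) 0 = 8 ^ 8 := by decide +kernel

/-- `8^8 · P(Q) = 12451840 = 95 · 8^8 / 128` (equal to the venture file's `massQ`). [folklore] -/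
private theorem sevenMassQ_eq : sevenMassQ = 12451840 := by decide +kernel
/-- `8^8 · E[f; Q] = 4587520 = 35 · 8^8 / 128`. [folklore] -/
private theorem sevenMassFQ_eq : sevenMassFQ = 4587520 := by decide +kernel
/-- `8^8 · E[g; Q] = 6553600 = 50 · 8^8 / 128`. [folklore] -/
private theorem sevenMassGQ_eq : sevenMassGQ = 6553600 := by decide +kernel
/-- `8^8 · E[fg; Q] = 2359296 = 18 · 8^8 / 128`. [folklore] -/
private theorem sevenMassFGQ_eq : sevenMassFGQ = 2359296 := by decide +kernel

/-- `P(Q) = 95/128` on `W1e7`. [folklore] -/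
private theorem seven_probQ : (sevenMassQ : ℚ) / 8 ^ 8 = 95 / 128 := by
  rw [sevenMassQ_eq]; norm_num

/-- The conditional covariance of `f`, `g` given `Q` on `W1e7` is `−8/1805`
[cite: VandenbergHaggstromKahn2005, §3, Theorem 3.4 and the following paragraph]. -/
theorem seven_conditional_covariance :
    (sevenMassFGQ : ℚ) / sevenMassQ - (sevenMassFQ / sevenMassQ) * (sevenMassGQ / sevenMassQ) =
      -8 / 1805 := by
  rw [sevenMassQ_eq, sevenMassFQ_eq, sevenMassGQ_eq, sevenMassFGQ_eq]; norm_num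

/-! ### The six-vertex minimal mechanism `K6` (venture file `BHKMixedCore.lean`, p371592) -/

/-- The seven edges of `K6` on vertices `0..5` (`s = 0`, `t = 1`, `x = 2`, `y = 3`, `s' = 4`, `t' = 5`):
arcs `s → x`, `x → s`, `t → y`, `y → t`, the one undirected edge `{x, y}`, pendant arcs `s → s'`, `t → t'`;
every weight `7/8` — verbatim the venture cell's list. [folklore] -/
def sixEdges : List MEdge :=
  [⟨true, 0, 2, 7⟩, ⟨true, 2, 0, 7⟩, ⟨true, 1, 3, 7⟩, ⟨true, 3, 1, 7⟩,
   ⟨false, 2, 3, 7⟩, ⟨true, 0, 4, 7⟩, ⟨true, 1, 5, 7⟩]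

/-- `f = 1[x ∈ V(C_s)]` on `K6` (`s = 0`, `x = 2`): increasing in `C_s`, constant in `C_t`. [folklore] -/
def sixF (c : Nat) : Bool := mem (VC sixEdges 6 c 0) 2

/-- `g = 1[y ∉ V(C_t)]` on `K6` (`t = 1`, `y = 3`): constant in `C_s`, decreasing in `C_t`. [folklore] -/
def sixG (c : Nat) : Bool := !(mem (VC sixEdges 6 c 1) 3)

/-- `8^7 · P(Q)` on `K6`. [folklore] -/
def sixMassQ : Nat := mass sixEdges 6 0 1 fun _ => true
/-- `8^7 · E[f; Q]` on `K6`. [folklore] -/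
def sixMassFQ : Nat := mass sixEdges 6 0 1 sixF
/-- `8^7 · E[g; Q]` on `K6`. [folklore] -/
def sixMassGQ : Nat := mass sixEdges 6 0 1 sixG
/-- `8^7 · E[fg; Q]` on `K6`. [folklore] -/
def sixMassFGQ : Nat := mass sixEdges 6 0 1 fun c => sixF c && sixG c

/-- Sanity: the weights of all `2^7` configurations of `K6` sum to `8^7`. [folklore] -/
private theorem six_total_mass :
    (List.range 128).foldl (fun a c => a + wt sixEdges c) 0 = 8 ^ 7 := by decide +kernel

/-- `8^7 · P(Q) = 384896 = 3007 · 128` (equal to the venture file's `massQ`). [folklore] -/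
private theorem sixMassQ_eq : sixMassQ = 384896 := by decide +kernel
/-- `8^7 · E[f; Q] = 276416 = 4319 · 64`. [folklore] -/
private theorem sixMassFQ_eq : sixMassFQ = 276416 := by decide +kernel
/-- `8^7 · E[g; Q] = 108480 = 1695 · 64`. [folklore] -/
private theorem sixMassGQ_eq : sixMassGQ = 108480 := by decide +kernel
/-- `8^7 · E[fg; Q] = 75712 = 1183 · 64`. [folklore] -/
private theorem sixMassFGQ_eq : sixMassFGQ = 75712 := by decide +kernel

/-- `P(Q) = 3007/16384` on `K6`. [folklore] -/
private theorem six_probQ : (sixMassQ : ℚ) / 8 ^ 7 = 3007 / 16384 := by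
  rw [sixMassQ_eq]; norm_num

/-- The conditional covariance of `f`, `g` given `Q` on `K6` is `−206143/36168196`
[cite: VandenbergHaggstromKahn2005, §3, Theorem 3.4 and the following paragraph]. -/
theorem six_conditional_covariance :
    (sixMassFGQ : ℚ) / sixMassQ - (sixMassFQ / sixMassQ) * (sixMassGQ / sixMassQ) =
      -206143 / 36168196 := by
  rw [sixMassQ_eq, sixMassFQ_eq, sixMassGQ_eq, sixMassFGQ_eq]; norm_num

end VdBHKMixed

open VdBHKMixed

/-- **BARRIER — the vdBHK mixed-graph conjecture is FALSE (seven-vertex witness `W1e7`, NEG-76).**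
As printed [cite: VandenbergHaggstromKahn2005, §3, Theorem 3.4]: "Assume `G` is a digraph in the usual
sense (that is, all its edges are directed). Let `s` and `t` be (distinct) vertices, and `f` and `g`
bounded, measurable functions of `(C_s, C_t)`, each increasing in `C_s` and decreasing in `C_t`. Then on
`Q := {V(C_s) ∩ V(C_t) = ∅}`, `E fg ≥ E f E g`", followed by
[cite: VandenbergHaggstromKahn2005, §3, paragraph after Theorem 3.4 (arXiv p. 18)]: "It's a little strange
that we can so far prove Theorem 3.4 only in the absence of undirected edges, and we conjecture that it
remains true without this restriction."  REFUTED: on the mixed graph `W1e7` (vertices `0..6`, `s = 5`,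
`t = 0`; undirected `{4,5}`, `{0,3}` sure, `{0,6}`, `{1,2}` at `1/2`; arcs `(2,3)` at `7/8`, `(1,4)`, `(4,1)`,
`(6,2)` at `1/2`) with `f = 1[1 ∈ V(C_s)]`, `g = 1[6 ∉ V(C_t)]` one has `E[fg | Q] < E[f | Q] · E[g | Q]`
(`18/95 < (7/19)(10/19)`; covariance `−8/1805`).

BARRIER (D-0021 structured block):
- technique_class: explicit finite counterexample / `decide +kernel` — MIXED-GRAPH TWO-CLUSTER
  CONDITIONING ON `Q`: arguments that would apply the conclusion of Theorem 3.4 (on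
  `Q = {V(C_s) ∩ V(C_t) = ∅}`, functions increasing in `C_s` and decreasing in `C_t` are positively
  correlated) to percolation on graphs carrying BOTH oriented and undirected independent edges
  [cite: VandenbergHaggstromKahn2005, §3, Theorem 3.4 and the following paragraph].
- blocks: the conjecture as stated for mixed graphs — "[Theorem 3.4] remains true without this restriction
  [that all edges are directed]" [cite: VandenbergHaggstromKahn2005, §3, paragraph after Theorem 3.4] —
  hence any transplant, to mixed or partially oriented models, of a gluing / two-cluster step whose engine
  would be that extension (e.g. a `Q`-conditioned reading of Kozma–Nitzan-type exchange lemmas on graphs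
  with some oriented bonds).  It does NOT block Theorem 3.4 itself (pure digraphs), nor the undirected
  two-cluster inequalities Theorems 1.4/1.5 under `{s ↮ t}` (tree: `BHK2006_twoClusterConditionalAssociation_holds`,
  `tripodExchange`), nor the single-source Theorems 3.1–3.2.
- because: one undirected edge shared between the forward clusters of `s` and `t` makes the
  `Q`-conditioned law negatively dependent across the two clusters — in the six-vertex core `K6`
  (`vdBHK_mixed_conjecture_false_six`: arcs `s ⇄ x`, `t ⇄ y`, undirected `{x,y}`, all weights `7/8`), given
  `Q` the events "`s → x` open" (raising `f = 1[x ∈ V(C_s)]`) and "`t → y` open" (lowering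
  `g = 1[y ∉ V(C_t)]`) cannot both coexist with an open `{x,y}`, so `Q` couples them; exact evaluation over
  all `2^7` configurations gives covariance `−206143/36168196` (`VdBHKMixed.six_conditional_covariance`),
  and over the `2^8` configurations of `W1e7` `−8/1805` (`VdBHKMixed.seven_conditional_covariance`).  This is
  the failure of the paper's Observation (U) in the presence of undirected edges, which the authors name as
  the obstacle to extending their proof [cite: VandenbergHaggstromKahn2005, §3, paragraph after Theorem 3.4].
- evasions_known: none needed for pure digraphs (Theorem 3.4 as printed stands, Markov-chain proof via
  Theorem 3.3 [cite: VandenbergHaggstromKahn2005, §3, Theorems 3.3–3.4]); for undirected graphs use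
  `{s ↮ t}` and Theorems 1.4/1.5 [cite: VandenbergHaggstromKahn2005, Thms. 1.4–1.5 (p. 7)]; no positive
  mixed-graph substitute is recorded in the tree.
- scope_caveats: the refutation reads the conjecture with the paper's own objects (`C_v` = open edges on
  open orientation-respecting paths from `v`, undirected edges two-way; `V(·)`; `Q`; conditional expectation
  given `Q`) and with indicator functions `f = 1[· ∈ V(C_s)]`, `g = 1[· ∉ V(C_t)]`, bounded, measurable,
  increasing in `C_s` and decreasing in `C_t` as Theorem 3.4 requires; edge probabilities are rational
  (`7/8`, `1/2`, `1`) and everything is decided by kernel evaluation of the explicit finite weighted sums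
  `VdBHKMixed.mass …` — no measure theory is invoked.  The entry classifies a TOOL; it says nothing about
  the truth of the undirected cruxes of `PercolationContinuityZ3`.
- status: REFUTED (kernel) — the printed conjecture is false; both witnesses PROVED in this file with
  axioms ⊆ {propext, Classical.choice, Quot.sound}.
- provenance: BLIND-DERIVED (pub-perc-repro2; p370416 `Summits/Ventures/PercRepro2/BHKMixedCounterexample.lean`
  — `Summit.Ventures.PercRepro2.BHKMixed.vdBHK_mixed_conjecture_false`, NEG-76, "re-derived exactly by three
  independent implementations"; p371592 `Summits/Ventures/PercRepro2/BHKMixedCore.lean` —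
  `Summit.Ventures.PercRepro2.BHKMixedCore.vdBHK_mixed_conjecture_false_six`).  Re-evaluated here (Literature
  may not import `Summits.Ventures`); the four masses of each witness agree with the venture files digit for
  digit. -/
theorem vdBHK_mixed_conjecture_false :
    (sevenMassFGQ : ℚ) / sevenMassQ < (sevenMassFQ / sevenMassQ) * (sevenMassGQ / sevenMassQ) := by
  rw [sevenMassQ_eq, sevenMassFQ_eq, sevenMassGQ_eq, sevenMassFGQ_eq]; norm_num

/-- **The vdBHK mixed-graph conjecture is false already on six vertices with every weight `7/8`** (the
minimal mechanism `K6`: arcs `s ⇄ x`, `t ⇄ y`, `s → s'`, `t → t'`, one undirected edge `{x, y}`;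
`f = 1[x ∈ V(C_s)]`, `g = 1[y ∉ V(C_t)]`):  `E[fg | Q] < E[f | Q] · E[g | Q]` on `Q = {V(C_s) ∩ V(C_t) = ∅}`
(`P(Q) = 3007/16384`, covariance `−206143/36168196`), contradicting "Theorem 3.4 remains true without this
restriction [to directed edges]" [cite: VandenbergHaggstromKahn2005, §3, Theorem 3.4 and the following paragraph].
BLIND-DERIVED (p371592, `Summit.Ventures.PercRepro2.BHKMixedCore.vdBHK_mixed_conjecture_false_six`). -/
theorem vdBHK_mixed_conjecture_false_six :
    (sixMassFGQ : ℚ) / sixMassQ < (sixMassFQ / sixMassQ) * (sixMassGQ / sixMassQ) := by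
  rw [sixMassQ_eq, sixMassFQ_eq, sixMassGQ_eq, sixMassFGQ_eq]; norm_num

end Literature.Barriers.CriticalPhenomena
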